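import Mathlib
import Summits.Ventures.PercRepro2.Defs
import Summits.Ventures.PercRepro2.Independence
import Summits.Ventures.PercRepro2.Harris
import Summits.Ventures.PercRepro2.Graph
import Summits.Ventures.PercRepro2.Events
import Summits.Ventures.PercRepro2.BHKEvents
import Summits.Ventures.PercRepro2.ZCPendantSecondOrder
import Summits.Ventures.PercRepro2.CDRequired
import Summits.Ventures.PercRepro2.GateCylinder
import Summits.Ventures.PercRepro2.CDCylinder
import Summits.Ventures.PercRepro2.CycleConn

/-!
# Row 2′CD when `{a₁ ↔ a₃}` is a cylinder UNDER `Q`, and on every cycle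
(blind cell PercRepro2, mine-a g34; MINE-A.md §89.5, proofs/MINEA-CD-CYCLE.md)

The cylinder theorem of `CDCylinder.lean` needs `{a₃ ∈ C₁} = cylinder B` outright.  Its proof only
ever uses the event `Q ∩ e`, so the hypothesis can be weakened to

  `Q ∩ {a₁ ↔ a₃} = Q ∩ cylinder B`,   `Q = {a₁ ↮ a₂}`

— "`{a₁ ↔ a₃}` is a cylinder in `G − a₂`": under `Q` no `a₁–a₃` path may pass through `a₂`, so it
suffices that the `a₁–a₃` paths avoiding `a₂` all use one fixed edge set `B`.  Forcing `B` open turns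
the `a₃`-required world into the plain `Q`-world of the forced vector (`GateCylinder.prob_inter_cylinder`),
where BHK06 Thm 1.4 (`bhk_cross_cluster`) is the required anti-correlation, and
`CDRequired.cd_of_required_anticorr` closes the row (`required_anticorr_of_cylinder_Q`,
`cd_of_cylinder_Q`).

**The cycle theorem** (`cd_cycle`).  On the `n`-cycle `cycN n` (`CycleConn.lean`, `V = E = Fin n`) the two
`a₁–a₃` routes are the two arcs, and the arc through `a₂` is closed under `Q`
(`CycleConn.conn_cycle_iff`); so `Q ∩ {a₁ ↔ a₃} = Q ∩ cylinder (the arc avoiding a₂)`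
(`Q_inter_connEvent_eq_cylinder`), and row 2′CD holds on every cycle, for every placement of the four
marks, every up-set and every weight vector — the first class theorem of the row on a 2-connected graph.
No definition; one seat.
-/

namespace Summit.Ventures.PercRepro2

namespace CDCycle

section General

variable {V : Type*} {E : Type*} [Fintype E] [DecidableEq E] [Fintype V] [DecidableEq V]
  {R : Type*} [Field R] [LinearOrder R] [IsStrictOrderedRing R]

/-- **The required-world anti-correlation when `{a₁ ↔ a₃}` is a cylinder under `Q`.** -/
theorem required_anticorr_of_cylinder_Q (p : E → R) (hp : IsProbVec p) (ends : E → Sym2 V)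
    (a₁ a₂ a₃ o : V) {𝓔 : Set (Set V)} (h𝓔 : IsUpperSet 𝓔) {B : Finset E}
    (hB : (connEvent ends a₁ a₂)ᶜ ∩ connEvent ends a₁ a₃ =
      (connEvent ends a₁ a₂)ᶜ ∩ GateCylinder.cylinder B) :
    prob p ((connEvent ends a₁ a₂)ᶜ ∩ clusterInEvent ends a₁ 𝓔 ∩ connEvent ends a₁ a₃ ∩
          connEvent ends a₂ o) * prob p ((connEvent ends a₁ a₂)ᶜ ∩ connEvent ends a₁ a₃) ≤
      prob p ((connEvent ends a₁ a₂)ᶜ ∩ clusterInEvent ends a₁ 𝓔 ∩ connEvent ends a₁ a₃) *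
        prob p ((connEvent ends a₁ a₂)ᶜ ∩ connEvent ends a₁ a₃ ∩ connEvent ends a₂ o) := by
  -- pointwise form of the hypothesis: under `Q`, `e` and the cylinder agree
  have hpt : ∀ ω, ω ∈ (connEvent ends a₁ a₂)ᶜ →
      (ω ∈ connEvent ends a₁ a₃ ↔ ω ∈ GateCylinder.cylinder B) := by
    intro ω hQ
    have h := Set.ext_iff.1 hB ω
    simp only [Set.mem_inter_iff] at h
    exact ⟨fun he => (h.1 ⟨hQ, he⟩).2, fun hc => (h.2 ⟨hQ, hc⟩).2⟩
  -- BHK06 Thm 1.4 in the forced world `forceOpen p B`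
  have key := bhk_cross_cluster (GateCylinder.forceOpen p B) (GateCylinder.isProbVec_forceOpen hp B)
    ends a₁ a₂ h𝓔 (ZCPendant.isUpperSet_mem_o (V := V) o)
  rw [ZCPendant.clusterInEvent_mem_o_eq] at key
  -- the four events, with the cylinder split off
  have e1 : (connEvent ends a₁ a₂)ᶜ ∩ clusterInEvent ends a₁ 𝓔 ∩ connEvent ends a₁ a₃ ∩
      connEvent ends a₂ o =
      (clusterInEvent ends a₁ 𝓔 ∩ connEvent ends a₂ o ∩ (connEvent ends a₁ a₂)ᶜ) ∩
        GateCylinder.cylinder B := by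
    ext ω; have h := hpt ω; simp only [Set.mem_inter_iff]; tauto
  have e2 : (connEvent ends a₁ a₂)ᶜ ∩ connEvent ends a₁ a₃ =
      (connEvent ends a₁ a₂)ᶜ ∩ GateCylinder.cylinder B := hB
  have e3 : (connEvent ends a₁ a₂)ᶜ ∩ clusterInEvent ends a₁ 𝓔 ∩ connEvent ends a₁ a₃ =
      (clusterInEvent ends a₁ 𝓔 ∩ (connEvent ends a₁ a₂)ᶜ) ∩ GateCylinder.cylinder B := by
    ext ω; have h := hpt ω; simp only [Set.mem_inter_iff]; tauto
  have e4 : (connEvent ends a₁ a₂)ᶜ ∩ connEvent ends a₁ a₃ ∩ connEvent ends a₂ o =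
      (connEvent ends a₂ o ∩ (connEvent ends a₁ a₂)ᶜ) ∩ GateCylinder.cylinder B := by
    ext ω; have h := hpt ω; simp only [Set.mem_inter_iff]; tauto
  rw [e1, e3, e4, e2, GateCylinder.prob_inter_cylinder, GateCylinder.prob_inter_cylinder,
    GateCylinder.prob_inter_cylinder, GateCylinder.prob_inter_cylinder]
  have hπ : 0 ≤ ∏ b ∈ B, p b := Finset.prod_nonneg fun b _ => hp.nonneg b
  exact CDCylinder.mul_mul_le_mul_mul hπ key

/-- **Row 2′CD when `{a₁ ↔ a₃}` is a cylinder under `Q`** (a cylinder in `G − a₂`): for every up-set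
`𝓔` and every admissible weight vector. -/
theorem cd_of_cylinder_Q (p : E → R) (hp : IsProbVec p) (ends : E → Sym2 V) (a₁ a₂ a₃ o : V)
    {𝓔 : Set (Set V)} (h𝓔 : IsUpperSet 𝓔) {B : Finset E}
    (hB : (connEvent ends a₁ a₂)ᶜ ∩ connEvent ends a₁ a₃ =
      (connEvent ends a₁ a₂)ᶜ ∩ GateCylinder.cylinder B) :
    let Q := (connEvent ends a₁ a₂)ᶜ
    let U := clusterInEvent ends a₁ 𝓔
    let e := connEvent ends a₁ a₃
    let f := connEvent ends a₂ o
    let N := (connEvent ends a₁ a₃)ᶜ ∩ (connEvent ends a₂ a₃)ᶜ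
    let oU := connEvent ends a₁ o ∪ connEvent ends a₂ o
    prob p (Q ∩ N) * (prob p Q * prob p (Q ∩ U ∩ e ∩ f) - prob p (Q ∩ U) * prob p (Q ∩ e ∩ f)) ≤
      prob p (Q ∩ N ∩ oU) * (prob p Q * prob p (Q ∩ U ∩ e) - prob p (Q ∩ U) * prob p (Q ∩ e)) :=
  CDRequired.cd_of_required_anticorr p hp ends a₁ a₂ a₃ o h𝓔
    (required_anticorr_of_cylinder_Q p hp ends a₁ a₂ a₃ o h𝓔 hB)

end General

section Cycle

open Cycle Fin.NatCast

variable {n : ℕ} [NeZero n]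

omit [NeZero n] in
/-- If `dist u v < dist u w` then the upward arc `[u, v)` is contained in `[u, w)`. -/
lemma upInterval_subset_of_dist_lt {u v w : Fin n} (h : dist u v < dist u w) :
    upInterval u v ⊆ upInterval u w := by
  intro i hi
  rw [mem_upInterval] at hi ⊢
  exact lt_trans hi h

/-- If the upward arc `[u, w)` is open and `dist u v < dist u w` then `u ↔ v`. -/
lemma conn_of_open_of_dist_lt (ω : Config (Fin n)) {u v w : Fin n} (h : dist u v < dist u w)
    (hw : ∀ i ∈ upInterval u w, ω i = true) : Conn (cycN n) ω u v :=
  conn_of_upInterval ω u v fun i hi => hw i (upInterval_subset_of_dist_lt h hi)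

/-- For `a₃` strictly between `a₁` and `a₂` on the upward arc (`0 < dist a₁ a₃ < dist a₁ a₂`),
`a₂` lies on the upward arc from `a₃` to `a₁`: `dist a₃ a₂ < dist a₃ a₁`. -/
lemma dist_lt_of_between {a₁ a₂ a₃ : Fin n} (h0 : 0 < dist a₁ a₃) (h : dist a₁ a₃ < dist a₁ a₂) :
    dist a₃ a₂ < dist a₃ a₁ := by
  have hmn : dist a₁ a₂ < n := dist_lt a₁ a₂
  have h1 := dist_add_add a₁ (dist a₁ a₃) (dist a₁ a₂) h.le hmn
  rw [add_dist, add_dist] at h1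
  have h2 := dist_add_add' a₁ (dist a₁ a₃) 0 h0 (lt_trans h hmn)
  rw [Nat.cast_zero, add_zero, add_dist] at h2
  rw [h1, h2]
  omega

/-- **Under `Q`, the connection `{a₁ ↔ a₃}` on the cycle is the cylinder of the arc avoiding `a₂`**:
the upward arc `[a₁, a₃)` when `a₃` comes before `a₂` going up from `a₁`, the upward arc `[a₃, a₁)`
otherwise (the other arc passes through `a₂`, which `Q` forbids). -/
theorem Q_inter_connEvent_eq_cylinder (a₁ a₂ a₃ : Fin n) :
    (connEvent (cycN n) a₁ a₂)ᶜ ∩ connEvent (cycN n) a₁ a₃ =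
      (connEvent (cycN n) a₁ a₂)ᶜ ∩ GateCylinder.cylinder
        (if dist a₁ a₃ < dist a₁ a₂ then upInterval a₁ a₃ else upInterval a₃ a₁) := by
  ext ω
  simp only [Set.mem_inter_iff, Set.mem_compl_iff, mem_connEvent, GateCylinder.cylinder,
    Set.mem_setOf_eq]
  constructor
  · rintro ⟨hQ, h13⟩
    refine ⟨hQ, ?_⟩
    rw [conn_cycle_iff] at h13
    split_ifs with hlt
    · rcases h13 with h | h
      · exact h
      · -- the arc `[a₃, a₁)` is open; it contains `[a₃, a₂)` unless `a₃ = a₁`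
        by_cases h0 : dist a₁ a₃ = 0
        · -- `a₃ = a₁`: the arc `[a₁, a₁)` is empty
          intro i hi
          rw [mem_upInterval, h0] at hi
          exact absurd hi (Nat.not_lt_zero _)
        · exfalso
          have h32 : Conn (cycN n) ω a₃ a₂ :=
            conn_of_open_of_dist_lt ω (dist_lt_of_between (Nat.pos_of_ne_zero h0) hlt) h
          exact hQ (conn_trans (conn_symm (conn_of_upInterval ω a₃ a₁ h)) h32)
    · rcases h13 with h | h
      · -- the arc `[a₁, a₃)` is open; it contains `[a₁, a₂)` since `a₂ ≠ a₃` comes first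
        exfalso
        have hne : dist a₁ a₂ ≠ dist a₁ a₃ := by
          intro heq
          have : a₂ = a₃ := eq_of_dist_eq heq
          subst this
          exact hQ (conn_of_upInterval ω a₁ a₂ h)
        have hlt' : dist a₁ a₂ < dist a₁ a₃ := lt_of_le_of_ne (not_lt.1 hlt) hne
        exact hQ (conn_of_open_of_dist_lt ω hlt' h)
      · exact h
  · rintro ⟨hQ, hB⟩
    refine ⟨hQ, ?_⟩
    split_ifs at hB with hlt
    · exact conn_of_upInterval ω a₁ a₃ hB
    · exact conn_symm (conn_of_upInterval ω a₃ a₁ hB)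

variable {R : Type*} [Field R] [LinearOrder R] [IsStrictOrderedRing R]

/-- **THE CYCLE THEOREM.** Row 2′CD holds on the `n`-cycle for every placement of the marks
`a₁, a₂, a₃, o`, every up-set `𝓔` of vertex sets and every admissible weight vector. -/
theorem cd_cycle (p : Fin n → R) (hp : IsProbVec p) (a₁ a₂ a₃ o : Fin n) {𝓔 : Set (Set (Fin n))}
    (h𝓔 : IsUpperSet 𝓔) :
    let Q := (connEvent (cycN n) a₁ a₂)ᶜ
    let U := clusterInEvent (cycN n) a₁ 𝓔
    let e := connEvent (cycN n) a₁ a₃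
    let f := connEvent (cycN n) a₂ o
    let N := (connEvent (cycN n) a₁ a₃)ᶜ ∩ (connEvent (cycN n) a₂ a₃)ᶜ
    let oU := connEvent (cycN n) a₁ o ∪ connEvent (cycN n) a₂ o
    prob p (Q ∩ N) * (prob p Q * prob p (Q ∩ U ∩ e ∩ f) - prob p (Q ∩ U) * prob p (Q ∩ e ∩ f)) ≤
      prob p (Q ∩ N ∩ oU) * (prob p Q * prob p (Q ∩ U ∩ e) - prob p (Q ∩ U) * prob p (Q ∩ e)) :=
  cd_of_cylinder_Q p hp (cycN n) a₁ a₂ a₃ o h𝓔 (Q_inter_connEvent_eq_cylinder a₁ a₂ a₃)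

end Cycle

end CDCycle

end Summit.Ventures.PercRepro2
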